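import Literature.NumberTheory.EllipticCurves.TwoDescentKummerBridgeLocal
import Mathlib.NumberTheory.NumberField.Completion.InfinitePlace
import HarnessLib

/-!
# Selmer classes at the real place: the `T₁`-component of the smallest root is positive

The archimedean condition of the complete `2`-descent (Silverman, *AEC*, Prop. X.1.4 at `v = ∞`;
for rational points the tree's `TwoDescentLocalI0.signBit_sub_of_lt_of_lt` /
`TwoDescentLinearConditions.descentRep_pos`): if `e₁` is the SMALLEST of the three real roots
`e₁ < e₂`, `e₁ < e₃` of `y² = (x - e₁)(x - e₂)(x - e₃)`, then on every real point `x - e₁ ≥ 0`, and the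
`T₁`-descent component of every point of `E(ℝ)` (`O ↦ 1`, `T₁ ↦ (e₁ - e₂)(e₁ - e₃) > 0`,
`(x, y) ↦ x - e₁ > 0`) is the class of a POSITIVE number: the local image at `∞` of the first
component is trivial in `ℝˣ/ℝˣ² = {±1}`. Carried over to Selmer classes over `ℚ` through the local
descent–Kummer bridge (`TwoDescentKummerBridgeLocal.exists_twoDescentComponent_eq_of_mem_selmerGroup`
at the infinite place, whose completion is identified with `ℝ` by Mathlib's
`NumberField.InfinitePlace.Completion.ringEquivRealOfIsReal`):

* `sub_pos_of_sq_eq_mul_mul_of_ne` — over a linearly ordered field, `z² = (X - e₁)(X - e₂)(X - e₃)`,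
  `e₁ < e₂`, `e₁ < e₃`, `X ≠ e₁` force `0 < X - e₁`;
* `exists_eq_mul_sq_of_mk_eq_sqClass` — `[u] = sqClass r` in `Fˣ/Fˣ²` means `r = u·s²`;
* `pos_of_mem_selmerGroup_of_lt` — **for `E/ℚ` with rational `2`-torsion `e₁ < e₂`, `e₁ < e₃` and
  `c ∈ Sel⁽²⁾(E/ℚ)` with global `T₁`-component `[a]`, `a ∈ ℚˣ`: `0 < a`** (the sign condition of a
  `2`-Selmer computation, in the currency of the tree's rank computations: `signBit a = 0`).

Theorems only; no named fact. Cell `bsd-monsky` (towards `#Sel⁽²⁾(E_{2pq}/ℚ) ≤ 8` as a kernel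
theorem: the place `∞`).

## References

* [SilvermanAEC2009] J. H. Silverman, *The Arithmetic of Elliptic Curves*, 2nd ed., GTM 106,
  Springer 2009, Prop. X.1.4 (the place `v = ∞` of `S`), Prop. X.4.9, Example X.4.10.
-/

noncomputable section

open scoped Classical

open WeierstrassCurve.Affine WeierstrassCurve.Affine.Point

namespace Literature.NumberTheory.EllipticCurves.TwoDescentLocal

/-- **The real condition of the `2`-descent, over any linearly ordered field**: on
`z² = (X - e₁)(X - e₂)(X - e₃)` with `e₁ < e₂`, `e₁ < e₃` and `X ≠ e₁`, `0 < X - e₁` (otherwise all three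
factors are negative and so is their product). [cite: SilvermanAEC2009, Prop. X.1.4] -/
theorem sub_pos_of_sq_eq_mul_mul_of_ne {L : Type*} [Field L] [LinearOrder L] [IsStrictOrderedRing L]
    {e₁ e₂ e₃ X z : L} (h12 : e₁ < e₂) (h13 : e₁ < e₃) (hX : X ≠ e₁)
    (h : z ^ 2 = (X - e₁) * (X - e₂) * (X - e₃)) : 0 < X - e₁ := by
  rcases lt_or_gt_of_ne (sub_ne_zero.mpr hX) with hlt | hgt
  · exfalso
    have h2 : X - e₂ < 0 := by linarith
    have h3 : X - e₃ < 0 := by linarith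
    have hprod : (X - e₁) * (X - e₂) * (X - e₃) < 0 := mul_neg_of_pos_of_neg (mul_pos_of_neg_of_neg hlt h2) h3
    have hz : 0 ≤ z ^ 2 := sq_nonneg z
    rw [h] at hz
    exact absurd hprod (not_lt.mpr hz)
  · exact hgt

/-- **A square class with a given representative**: `[u] = sqClass r` in `Fˣ/Fˣ²` (`r ≠ 0`) means
`r = u · s²` for some `s ≠ 0`. [cite: SilvermanAEC2009, X.§1 (Example X.1.5)] -/
theorem exists_eq_mul_sq_of_mk_eq_sqClass {F : Type*} [Field F] {u : Fˣ} {r : F} (hr : r ≠ 0)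
    (h : (QuotientGroup.mk u : SqUnits F) = sqClass r) : ∃ s : F, s ≠ 0 ∧ r = u * s ^ 2 := by
  rw [sqClass_of_ne_zero hr, QuotientGroup.eq] at h
  obtain ⟨s, hs⟩ := h
  refine ⟨s, s.ne_zero, ?_⟩
  have := congrArg Units.val hs
  rw [powMonoidHom_apply, Units.val_pow_eq_pow_val, Units.val_mul, Units.val_inv_eq_inv_val,
    Units.val_mk0] at this
  rw [this]
  field_simp

end Literature.NumberTheory.EllipticCurves.TwoDescentLocal

open Field NumberField

universe u

namespace WeierstrassCurve

open Literature.NumberTheory.GaloisRepresentations Literature.NumberTheory.EllipticCurves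
open Literature.NumberTheory.EllipticCurves.TwoDescentLocal WeierstrassCurve.Affine

/-- The identification `ℚ_w ≃+* ℝ` of the completion of `ℚ` at a (real) infinite place sends the
image of a rational `a` to `a` (every infinite place of `ℚ` is real: the tree's
`Rat.isReal_infinitePlace'`, Mathlib's `Rat.isReal_infinitePlace`). [cite: SilvermanAEC2009, Prop. X.1.4] -/
theorem ringEquivRealOfIsReal_algebraMap (w : InfinitePlace ℚ) (hw : w.IsReal) (a : ℚ) :
    InfinitePlace.Completion.ringEquivRealOfIsReal hw (algebraMap ℚ w.Completion a) = (a : ℝ) :=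
  eq_ratCast ((InfinitePlace.Completion.ringEquivRealOfIsReal hw).toRingHom.comp (algebraMap ℚ w.Completion)) a

/-- **The `T₁`-component of the smallest root is positive on `E(ℚ_∞)`** (Silverman AEC Prop. X.1.4
at `v = ∞`): for `E/ℚ` with rational `2`-torsion `e₁ < e₂`, `e₁ < e₃`, an infinite place `w` of `ℚ`,
and a point `P ∈ E(ℚ_w)` whose `T₁`-descent component is the class of `algebraMap a`, `a ∈ ℚˣ`:
`0 < a`. [cite: SilvermanAEC2009, Prop. X.1.4] -/
theorem pos_of_twoDescentComponent_eq_infinitePlace (W : WeierstrassCurve ℚ) [W.IsElliptic]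
    {e₁ e₂ e₃ : ℚ} (h : W.toAffine.SplitTwoTorsion e₁ e₂ e₃) (h12 : e₁ < e₂) (h13 : e₁ < e₃)
    (w : InfinitePlace ℚ) (hw : w.IsReal) [(W.baseChange w.Completion).IsElliptic]
    (P : (W.baseChange w.Completion).toAffine.Point) (a : ℚˣ)
    (hP : Affine.Point.twoDescentComponent (W.baseChange w.Completion).toAffine
        (algebraMap ℚ w.Completion e₁) (algebraMap ℚ w.Completion e₂) (algebraMap ℚ w.Completion e₃) P =
      QuotientGroup.mk (Units.map (algebraMap ℚ w.Completion : ℚ →* w.Completion) a)) :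
    0 < (a : ℚ) := by
  set ι := algebraMap ℚ w.Completion with hι
  set φ := InfinitePlace.Completion.ringEquivRealOfIsReal hw with hφ
  have hφι : ∀ r : ℚ, φ (ι r) = (r : ℝ) := ringEquivRealOfIsReal_algebraMap w hw
  have hφa : φ ((Units.map (ι : ℚ →* w.Completion) a : w.Completionˣ) : w.Completion) = (a : ℝ) := by
    rw [Units.coe_map, MonoidHom.coe_coe]; exact hφι a
  -- it suffices to exhibit `s ≠ 0` and `r > 0` real with `a · φ(s)² = r`-type identities
  suffices key : ∃ r : w.Completion, r ≠ 0 ∧ 0 < φ r ∧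
      Affine.Point.twoDescentComponent (W.baseChange w.Completion).toAffine (ι e₁) (ι e₂) (ι e₃) P =
        sqClass r by
    obtain ⟨r, hr0, hrpos, hPr⟩ := key
    obtain ⟨s, hs0, hrs⟩ := exists_eq_mul_sq_of_mk_eq_sqClass hr0 (hP.symm.trans hPr)
    have hreal : φ r = (a : ℝ) * φ s ^ 2 := by rw [hrs, map_mul, map_pow, hφa]
    have hs2 : 0 < φ s ^ 2 := by
      have : φ s ≠ 0 := (map_ne_zero_iff φ φ.injective).mpr hs0
      positivity
    have : 0 < (a : ℝ) := by
      by_contra hle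
      have hle' : (a : ℝ) ≤ 0 := not_lt.mp hle
      have : φ r ≤ 0 := by rw [hreal]; exact mul_nonpos_of_nonpos_of_nonneg hle' hs2.le
      linarith
    exact_mod_cast this
  have hsplit := h.map w.Completion
  rcases P with _ | ⟨x, y, hxy⟩
  · refine ⟨1, one_ne_zero, by rw [map_one]; exact one_pos, ?_⟩
    rw [← zero_def, twoDescentComponent_zero, ← mul_one (1 : w.Completion), sqClass_mul_self]
  by_cases hx : x = ι e₁
  · refine ⟨(ι e₁ - ι e₂) * (ι e₁ - ι e₃), hsplit.c_ne_zero, ?_,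
      twoDescentComponent_some_of_eq hxy hx⟩
    rw [map_mul, map_sub, map_sub, hφι, hφι, hφι]
    have h1 : (e₁ : ℝ) - e₂ < 0 := by exact_mod_cast (sub_neg.mpr h12)
    have h2 : (e₁ : ℝ) - e₃ < 0 := by exact_mod_cast (sub_neg.mpr h13)
    exact mul_pos_of_neg_of_neg h1 h2
  · refine ⟨x - ι e₁, sub_ne_zero.mpr hx, ?_, twoDescentComponent_some_of_ne hxy hx⟩
    -- `CharZero ℚ_w` only now: an earlier instance would re-route `algebraMap ℚ ℚ_w` through `Rat.cast`
    haveI : CharZero w.Completion := charZero_of_injective_algebraMap ι.injective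
    have hsq := sq_eq_mul_mul_of_equation hsplit hxy.1
    have hsqR := congrArg φ hsq
    rw [map_pow, map_mul, map_mul, map_sub, map_sub, map_sub, hφι, hφι, hφι] at hsqR
    have hX : φ x ≠ (e₁ : ℝ) := by
      intro hX
      apply hx
      apply φ.injective
      rw [hX, hφι]
    have h1 : (e₁ : ℝ) < e₂ := by exact_mod_cast h12
    have h2 : (e₁ : ℝ) < e₃ := by exact_mod_cast h13
    rw [map_sub, hφι]
    exact sub_pos_of_sq_eq_mul_mul_of_ne h1 h2 hX hsqR

/-- **Selmer classes are positive in the `T₁`-component of the smallest root** (Silverman AEC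
Prop. X.1.4 / X.4.9 at the real place): for `E/ℚ` with rational `2`-torsion `e₁ < e₂`, `e₁ < e₃` and
`c ∈ Sel⁽²⁾(E/ℚ)` with global `T₁`-component `[a]`, `a ∈ ℚˣ`, one has `0 < a` — the real point of
`E(ℝ)` behind the localised class has `x - e₁ > 0`. [cite: SilvermanAEC2009, Prop. X.1.4, Prop. X.4.9] -/
theorem pos_of_mem_selmerGroup_of_lt (W : WeierstrassCurve ℚ) [W.IsElliptic] {e₁ e₂ e₃ : ℚ}
    (h : W.toAffine.SplitTwoTorsion e₁ e₂ e₃) (h12 : e₁ < e₂) (h13 : e₁ < e₃) {c : galH1Torsion W 2}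
    (hc : c ∈ selmerGroup W 2) (a : ℚˣ)
    (ha : kummerEquiv ℚ 2 (W.twoTorsionCharH1 h c) = Additive.ofMul (QuotientGroup.mk a)) :
    0 < (a : ℚ) := by
  let w : InfinitePlace ℚ := Rat.infinitePlace
  haveI : (W.baseChange w.Completion).IsElliptic := W.isElliptic_baseChange _
  haveI : (W.baseChange (Place.Completion (Sum.inl w : Place ℚ))).IsElliptic := W.isElliptic_baseChange _
  haveI : CharZero (Place.Completion (Sum.inl w : Place ℚ)) :=
    charZero_of_injective_algebraMap (algebraMap ℚ w.Completion).injective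
  obtain ⟨P, hP⟩ := W.exists_twoDescentComponent_eq_of_mem_selmerGroup h hc (Sum.inl w : Place ℚ) a ha
  exact W.pos_of_twoDescentComponent_eq_infinitePlace h h12 h13 w Rat.isReal_infinitePlace P a hP

end WeierstrassCurve

end
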